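import Literature.AlgebraicGeometry.Resolution.ConjugateBoundCoefficients
import HarnessLib

/-!
# Placing elements of the function field in the model: powers of a separating unit

Topic: `Literature/AlgebraicGeometry/Resolution` (valued function fields; models over valuation
rings). Groundwork for the algebraization step of M. Temkin, *Inseparable local uniformization*,
J. Algebra 373 (2013) = arXiv:0804.1554v3, Thm. 3.3.1 (tree: the named fact
`Temkin2013RelativeCurveSmoothFibre`). Setting: `L ⊇ F` a finite extension of function fields
inside one valued field `(Ω, V)`, and a finite family of embeddings `θᵢ : L → Ω` (in the
application: all embeddings compatible with finitely many embeddings of `F`), each of which either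
induces the SAME values as the inclusion or makes a fixed element `s ∈ L` (the separating unit of
`SeparatingUnit.lean`) strictly smaller than `1`, while `|θᵢ s| ≤ 1` always. Then for every
`z ∈ L` with `|z| ≤ r` (`r > 0`) a single power `sᴹ` achieves `|θᵢ (z sᴹ)| ≤ r` for all `i`
(the value group being archimedean), uniformly for finitely many `z`. With `θ` the family of all
`F`-embeddings and `r = 1` this makes `z sᴹ` integral over `O_F = F ∩ O_V`
(`ConjugateBoundCoefficients.lean`), so that refining the `F`-rational model by the coefficients
of its minimal polynomial puts `z sᴹ` into the normalization and `z` into its localization at the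
`V`-unit `s` — a CONTROLLED form of `FineModels.exists_fine_model` in which the denominator is the
prescribed `s` and the new generators are explicit minimal-polynomial coefficients.

* `exists_pow_mul_valuation_apply_le`, `exists_pow_mul_forall_valuation_apply_le` — one `M` for
  one `z`, resp. for a finite set of `z` — PROVED;
* `exists_pow_mul_forall_algHom_mem` — the case of all `F`-embeddings and `r = 1`: `σ (z sᴹ) ∈ O_V`
  for all `σ : L →ₐ[F] Ω` — PROVED;
* `exists_generators_forall_mem_nrIn_mul_pow` — **controlled fine generators**: finitely many
  explicit elements of `O_F` (coefficients of the minimal polynomials over `F` of `s` and of the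
  `z sᴹ`) such that every subring `A″` of `F` containing them has `s ∈ Nr_L(A″)` and
  `z sᴹ ∈ Nr_L(A″)` for all `z` in the given finite set — PROVED.

All statements are [folklore]; no definitions, no named facts.

## Sources

* M. Temkin, arXiv:0804.1554v3, proof of Thm. 3.3.1, Step 3 (p. 45) (the use).
* N. Bourbaki, *Algèbre commutative* VI §7 no. 2 (approximation), §8 no. 6 (integral closure of
  a valuation ring), through the tree (`SeparatingUnit.lean`, `ConjugateBoundCoefficients.lean`).
-/

noncomputable section

open Polynomial

namespace Literature.AlgebraicGeometry.Resolution

universe u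

variable {Ω : Type u} [Field Ω] (V : ValuationSubring Ω)

/-! ### One power of the separating unit for finitely many elements and embeddings -/

section Powers

variable {L : Type*} [Field L] [Algebra L Ω]

/-- **One element.** Let `θᵢ : L → Ω` (`i ∈ ι`, finite) be ring embeddings and `s ∈ L` with
`|θᵢ s| ≤ 1` for all `i`, and for each `i` either `θᵢ` induces the same values as the inclusion
(`|θᵢ y| = |y|` for all `y`) or `|θᵢ s| < 1`. If the value group is archimedean (for `|x| < 1`
and any `y` some `|xᴺ y| < 1`), then for `z ∈ L` with `|z| ≤ r`, `r > 0`, there is `M` with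
`|θᵢ (z sᴹ)| ≤ r` for all `i`. [folklore] -/
theorem exists_pow_mul_valuation_apply_le {ι : Type*} [Fintype ι] (θ : ι → (L →+* Ω)) (s : L)
    (hs : ∀ i, (∀ y : L, V.valuation (θ i y) = V.valuation (algebraMap L Ω y)) ∨
      V.valuation (θ i s) < 1)
    (hs1 : ∀ i, V.valuation (θ i s) ≤ 1)
    (harch : ∀ x y : Ω, V.valuation x < 1 → ∃ N : ℕ, V.valuation (x ^ N * y) < 1)
    (z : L) {r : V.ValueGroup} (hr : 0 < r) (hz : V.valuation (algebraMap L Ω z) ≤ r) :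
    ∃ M : ℕ, ∀ i, V.valuation (θ i (z * s ^ M)) ≤ r := by
  classical
  -- an exponent for each `i`
  have hi : ∀ i, ∃ N : ℕ, ∀ M, N ≤ M → V.valuation (θ i (z * s ^ M)) ≤ r := by
    intro i
    rcases hs i with hsame | hlt
    · refine ⟨0, fun M _ => ?_⟩
      rw [hsame, map_mul, map_pow, map_mul, map_pow]
      calc V.valuation (algebraMap L Ω z) * V.valuation (algebraMap L Ω s) ^ M
          ≤ r * 1 := by
            refine mul_le_mul' hz (pow_le_one₀ zero_le ?_)
            rw [← hsame s]; exact hs1 i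
        _ = r := mul_one r
    · obtain ⟨ρ, hρ⟩ := V.valuation_surjective r
      have hρ0 : ρ ≠ 0 := fun h0 => by
        rw [h0, map_zero] at hρ
        exact hr.ne hρ
      obtain ⟨N, hN⟩ := harch (θ i s) (θ i z / ρ) hlt
      refine ⟨N, fun M hM => ?_⟩
      have hle : V.valuation (θ i s) ^ M ≤ V.valuation (θ i s) ^ N :=
        pow_le_pow_right_of_le_one' (hs1 i) hM
      have hθ : θ i (z * s ^ M) = θ i z * θ i s ^ M := by rw [map_mul, map_pow]
      rw [hθ, map_mul, map_pow, mul_comm]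
      have h1 : V.valuation (θ i s) ^ N * V.valuation (θ i z) < r := by
        have h := hN
        rw [map_mul, map_pow, map_div₀, hρ, ← mul_div_assoc, div_lt_one₀ hr] at h
        exact h
      exact (lt_of_le_of_lt (mul_le_mul' hle le_rfl) h1).le
  choose N hN using hi
  refine ⟨Finset.univ.sup N, fun i => hN i _ (Finset.le_sup (Finset.mem_univ i))⟩

/-- **Finitely many elements.** The same with one `M` for all `z` in a finite set `Z` (all with
`|z| ≤ r`). [folklore] -/
theorem exists_pow_mul_forall_valuation_apply_le {ι : Type*} [Fintype ι] (θ : ι → (L →+* Ω))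
    (s : L)
    (hs : ∀ i, (∀ y : L, V.valuation (θ i y) = V.valuation (algebraMap L Ω y)) ∨
      V.valuation (θ i s) < 1)
    (hs1 : ∀ i, V.valuation (θ i s) ≤ 1)
    (harch : ∀ x y : Ω, V.valuation x < 1 → ∃ N : ℕ, V.valuation (x ^ N * y) < 1)
    (Z : Finset L) {r : V.ValueGroup} (hr : 0 < r)
    (hZ : ∀ z ∈ Z, V.valuation (algebraMap L Ω z) ≤ r) :
    ∃ M : ℕ, ∀ z ∈ Z, ∀ i, V.valuation (θ i (z * s ^ M)) ≤ r := by
  classical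
  have hz : ∀ z : Z, ∃ N : ℕ, ∀ M, N ≤ M → ∀ i, V.valuation (θ i ((z : L) * s ^ M)) ≤ r := by
    intro z
    obtain ⟨N, hN⟩ := exists_pow_mul_valuation_apply_le V θ s hs hs1 harch z hr (hZ z z.2)
    refine ⟨N, fun M hM i => ?_⟩
    -- increasing the exponent only decreases the value
    have hle : V.valuation (θ i ((z : L) * s ^ M)) ≤ V.valuation (θ i ((z : L) * s ^ N)) := by
      rw [map_mul, map_pow, map_mul, map_pow, map_mul, map_mul, map_pow, map_pow]
      exact mul_le_mul' le_rfl (pow_le_pow_right_of_le_one' (hs1 i) hM)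
    exact hle.trans (hN i)
  choose N hN using hz
  refine ⟨Finset.univ.sup N, fun z hz i => ?_⟩
  exact hN ⟨z, hz⟩ _ (Finset.le_sup (Finset.mem_univ (⟨z, hz⟩ : Z))) i

end Powers

/-! ### All `F`-embeddings: integrality over `O_F` and controlled fine generators -/

section Embeddings

variable [IsAlgClosed Ω] {F L : Type u} [Field F] [Field L] [Algebra F L] [Algebra F Ω]
  [Algebra L Ω] [FiniteDimensional F L]

omit [IsAlgClosed Ω] in
/-- **Placement by a power of the separating unit.** With `θ` the (finite) family of all
`F`-embeddings `σ : L → Ω`: if each `σ` induces the values of the inclusion or has `|σ s| < 1`,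
and `|σ s| ≤ 1` always, then for a finite `Z ⊆ L ∩ O_V` one power `sᴹ` gives `σ (z sᴹ) ∈ O_V`
for all `σ` and all `z ∈ Z`. [folklore] -/
theorem exists_pow_mul_forall_algHom_mem (s : L)
    (hs : ∀ σ : L →ₐ[F] Ω, (∀ y : L, V.valuation (σ y) = V.valuation (algebraMap L Ω y)) ∨
      V.valuation (σ s) < 1)
    (hs1 : ∀ σ : L →ₐ[F] Ω, σ s ∈ V)
    (harch : ∀ x y : Ω, V.valuation x < 1 → ∃ N : ℕ, V.valuation (x ^ N * y) < 1)
    (Z : Finset L) (hZ : ∀ z ∈ Z, algebraMap L Ω z ∈ V) :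
    ∃ M : ℕ, ∀ z ∈ Z, ∀ σ : L →ₐ[F] Ω, σ (z * s ^ M) ∈ V := by
  classical
  have h1 : (0 : V.ValueGroup) < 1 := zero_lt_one
  obtain ⟨M, hM⟩ := exists_pow_mul_forall_valuation_apply_le V
    (fun σ : L →ₐ[F] Ω => (σ : L →+* Ω)) s (fun σ => hs σ)
    (fun σ => (V.valuation_le_one_iff _).mpr (hs1 σ)) harch Z h1
    (fun z hz => (V.valuation_le_one_iff _).mpr (hZ z hz))
  exact ⟨M, fun z hz σ => (V.valuation_le_one_iff _).mp (hM z hz σ)⟩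

/-- **Controlled fine generators.** In the situation of `exists_pow_mul_forall_algHom_mem`
there are `M` and a finite set `s′ ⊆ O_F = F ∩ O_V` of elements each of which is a coefficient of
the minimal polynomial over `F` of `s` or of some `z sᴹ`, `z ∈ Z`, such that for EVERY subring
`A″` of `F` containing `s′`: `s ∈ Nr_L(A″)` and `z sᴹ ∈ Nr_L(A″)` for all `z ∈ Z` (so
`z ∈ Nr_L(A″)[1/s]`, `s` a unit of `O_V`). [folklore] -/
theorem exists_generators_forall_mem_nrIn_mul_pow (s : L)
    (hs : ∀ σ : L →ₐ[F] Ω, (∀ y : L, V.valuation (σ y) = V.valuation (algebraMap L Ω y)) ∨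
      V.valuation (σ s) < 1)
    (hs1 : ∀ σ : L →ₐ[F] Ω, σ s ∈ V)
    (harch : ∀ x y : Ω, V.valuation x < 1 → ∃ N : ℕ, V.valuation (x ^ N * y) < 1)
    (Z : Finset L) (hZ : ∀ z ∈ Z, algebraMap L Ω z ∈ V) :
    ∃ (M : ℕ) (s' : Finset F), (↑s' : Set F) ⊆ (V.comap (algebraMap F Ω) : Set F) ∧
      (∀ g ∈ s', (∃ i, g = (minpoly F s).coeff i) ∨
        ∃ z ∈ Z, ∃ i, g = (minpoly F (z * s ^ M)).coeff i) ∧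
      ∀ A'' : Subring F, (↑s' : Set F) ⊆ A'' →
        s ∈ nrIn (A''.map (algebraMap F L)) ∧
        ∀ z ∈ Z, z * s ^ M ∈ nrIn (A''.map (algebraMap F L)) := by
  classical
  obtain ⟨M, hM⟩ := exists_pow_mul_forall_algHom_mem V s hs hs1 harch Z hZ
  -- the generators for `s` and for each `z sᴹ`
  obtain ⟨t₀, ht₀O, ht₀c, ht₀⟩ := exists_finset_coeff_minpoly_of_forall_algHom_mem V (K := F) s hs1
  have hw : ∀ z : Z, ∃ t : Finset F, (↑t : Set F) ⊆ (V.comap (algebraMap F Ω) : Set F) ∧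
      (∀ c ∈ t, ∃ i, c = (minpoly F ((z : L) * s ^ M)).coeff i) ∧
      ∀ A'' : Subring F, (↑t : Set F) ⊆ A'' →
        (z : L) * s ^ M ∈ nrIn (A''.map (algebraMap F L)) := fun z =>
    exists_finset_coeff_minpoly_of_forall_algHom_mem V ((z : L) * s ^ M) (hM z z.2)
  choose t htO htc ht using hw
  refine ⟨M, t₀ ∪ Finset.univ.biUnion t, ?_, ?_, fun A'' hA'' => ⟨?_, fun z hz => ?_⟩⟩
  · intro g hg
    rcases Finset.mem_union.mp (Finset.mem_coe.mp hg) with hg | hg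
    · exact ht₀O hg
    · obtain ⟨z, -, hgz⟩ := Finset.mem_biUnion.mp hg
      exact htO z hgz
  · intro g hg
    rcases Finset.mem_union.mp hg with hg | hg
    · exact Or.inl (ht₀c g hg)
    · obtain ⟨z, -, hgz⟩ := Finset.mem_biUnion.mp hg
      obtain ⟨i, hi⟩ := htc z g hgz
      exact Or.inr ⟨z, z.2, i, hi⟩
  · exact ht₀ A'' fun g hg => hA'' (Finset.mem_coe.mpr (Finset.mem_union_left _ hg))
  · refine ht ⟨z, hz⟩ A'' fun g hg => hA'' (Finset.mem_coe.mpr (Finset.mem_union_right _ ?_))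
    exact Finset.mem_biUnion.mpr ⟨⟨z, hz⟩, Finset.mem_univ _, hg⟩

/-- **Controlled fine model.** Refining an affine normalized model `A′` of `F°` by the
generators of `exists_generators_forall_mem_nrIn_mul_pow` (they lie in `O_F = F°`, `hO`) gives
`A″ ≥ A′` with `s ∈ Nr_L(A″)` and `z sᴹ ∈ Nr_L(A″)` for all `z ∈ Z`. [folklore] -/
theorem exists_refine_forall_mem_nrIn_mul_pow {O : ValuationSubring F}
    (hO : V.comap (algebraMap F Ω) = O) {R₀ A' : Subring F} (hA' : IsAffineNormalizedModel O R₀ A')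
    (s : L)
    (hs : ∀ σ : L →ₐ[F] Ω, (∀ y : L, V.valuation (σ y) = V.valuation (algebraMap L Ω y)) ∨
      V.valuation (σ s) < 1)
    (hs1 : ∀ σ : L →ₐ[F] Ω, σ s ∈ V)
    (harch : ∀ x y : Ω, V.valuation x < 1 → ∃ N : ℕ, V.valuation (x ^ N * y) < 1)
    (Z : Finset L) (hZ : ∀ z ∈ Z, algebraMap L Ω z ∈ V) :
    ∃ (A'' : Subring F) (M : ℕ) (s' : Finset F), A' ≤ A'' ∧ IsAffineNormalizedModel O R₀ A'' ∧
      (↑s' : Set F) ⊆ A'' ∧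
      (∀ g ∈ s', (∃ i, g = (minpoly F s).coeff i) ∨
        ∃ z ∈ Z, ∃ i, g = (minpoly F (z * s ^ M)).coeff i) ∧
      s ∈ nrIn (A''.map (algebraMap F L)) ∧
      ∀ z ∈ Z, z * s ^ M ∈ nrIn (A''.map (algebraMap F L)) := by
  obtain ⟨M, s', hs'O, hs'c, hs'⟩ :=
    exists_generators_forall_mem_nrIn_mul_pow V s hs hs1 harch Z hZ
  rw [hO] at hs'O
  obtain ⟨A'', hA'A'', hA'', hs'A''⟩ := hA'.refine s' hs'O
  exact ⟨A'', M, s', hA'A'', hA'', hs'A'', hs'c, (hs' A'' hs'A'').1, (hs' A'' hs'A'').2⟩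

end Embeddings

end Literature.AlgebraicGeometry.Resolution

end
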